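import Mathlib
import HarnessLib
import Literature.MathematicalPhysics.QuantumLattice.HubbardTwoPointMoments
import Literature.MathematicalPhysics.QuantumLattice.HubbardGridCounterQuadratic
import Literature.MathematicalPhysics.QuantumLattice.FejerTopCutoff

/-!
# Finite-cutoff Parseval for the local density insertion:
# `Σ_x ∫₀^β ⟨ψ⁺_{(x,t)σ} ψ⁻_{(x,t)σ} · E⟩ dt = (βL²)⁻¹ Σ_k ⟨ψ̂⁺_{kσ} ψ̂⁻_{kσ} · E⟩` (seat hubbard-kl-k3c5-p2, g2)

Route `KLProgramme`, gen-4 child 5 `KLRegimeVolumeLimitV12` (stmt-HubbardSuperconductivity-19858), clause (i) (`stub_vl_bound`), Step 2 of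
HOME/hubbard-kl-k3c5-p2/TAU-BRIDGE.md §6.  In the exact bare-frame form `Σ̂⁰ = (βL²/Z)(U(βL²)⁻³∫e^{−V}Σ_qψ̂⁺_{qσ̄}ψ̂⁻_{qσ̄} + U²·…)`
(`…VolumeLimitDysonHartreeCurrent`) the `U`-linear term carries the momentum-summed density bilinear `Σ_q ψ̂⁺_{qσ̄}ψ̂⁻_{qσ̄}`.  At FINITE cutoff
`M` (continuous imaginary time, `2M` kept frequencies) the position–time fields `positionField` (BGM (2.5)) satisfy the exact Parseval identity

  `Σ_{x ∈ 𝕋_L} ∫_{[0,β]} gaussExpect C (ψ⁺_{(x,t)σ} · ψ⁻_{(x,t)σ} · E) dt = (βL²)⁻¹ · Σ_k gaussExpect C (ψ̂⁺_{kσ} · ψ̂⁻_{kσ} · E)`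

for EVERY covariance matrix `C` and EVERY cofactor `E` (`sum_integral_gaussExpect_positionField_pair_mul`): the time integral is the frequency
orthogonality `∫₀^β e^{2πi(n−n′)t/β}dt = β[n = n′]` (`integral_Icc_exp_freqTransfer`), the site sum the character orthogonality
`Σ_x χ_k(x)conj χ_{k′}(x) = L²[k⃗ = k⃗′]` (`sum_torusChar_right`).  Hence the `U`-linear term of `Σ̂⁰` is `U` times the space–time AVERAGE of the
normalised local insertion `⟨ψ⁺_{(x,t)σ̄}ψ⁻_{(x,t)σ̄}⟩_{L,M}`, whose `M → ∞` limit at each `(x,t)` is t2's equal-time two-point identification.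
Everything is proved; no definition.
-/

noncomputable section

namespace Summit.HubbardSuperconductivity.HubbardSuperconductivity.Theorems.TwoPointAssembly

set_option linter.dupNamespace false -- summit = problem name (single-conjunct summit), D-0017

open Finset MeasureTheory Literature.MathematicalPhysics.QuantumLattice Literature.Probability.LatticeModels GrassmannAlgebra
open scoped ComplexConjugate

variable {L M : ℕ} [NeZero L]

/-- **Space–time orthogonality of the two leg phases**: for `β > 0`,
`Σ_x ∫_{[0,β]} conj(e^{-ik·(x,t)})·conj(e^{+ik′·(x,t)}) dt = βL²·[k = k′]`. -/
theorem sum_integral_conj_vertexPlaneWave_zero_mul_one {β : ℝ} (hβ : 0 < β) (k k' : FreqMomentum L M) :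
    ∑ x : TorusSite 2 L, ∫ t in Set.Icc (0 : ℝ) β, conj (vertexPlaneWave L M β 0 k x t) * conj (vertexPlaneWave L M β 1 k' x t) =
      if k = k' then ((β * (L : ℝ) ^ 2 : ℝ) : ℂ) else 0 := by
  simp_rw [conj_vertexPlaneWave_zero_mul_one_eq, integral_mul_const, integral_Icc_exp_freqTransfer hβ, ← Finset.mul_sum,
    ← torusChar_sub_left, sum_torusChar_right, sub_eq_zero]
  by_cases h : k = k'
  · subst h; simp
  · rw [if_neg h]
    by_cases h1 : matsubaraInt M k.1 = matsubaraInt M k'.1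
    · have h2 : k.2 ≠ k'.2 := fun h2 => h (Prod.ext (matsubaraInt_injective M h1) h2)
      rw [if_neg h2, mul_zero]
    · rw [if_neg h1, zero_mul]

/-- The local pair at a space–time point, expanded in momentum modes:
`ψ⁺_{(x,t)σ}·ψ⁻_{(x,t)σ}·E = Σ_k Σ_{k′} ((βL²)⁻² conj w⁰_k(x,t) conj w¹_{k′}(x,t)) • (ψ̂⁺_{kσ} ψ̂⁻_{k′σ} E)`. -/
theorem positionField_pair_mul_eq_sum (β : ℝ) (σ : Fin 2) (x : TorusSite 2 L) (t : ℝ) (E : HubbardGrassmann L M) :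
    positionField L M β 0 σ x t * positionField L M β 1 σ x t * E =
      ∑ k : FreqMomentum L M, ∑ k' : FreqMomentum L M,
        ((((1 / (β * (L : ℝ) ^ 2) : ℝ) : ℂ)) ^ 2 * (conj (vertexPlaneWave L M β 0 k x t) * conj (vertexPlaneWave L M β 1 k' x t))) •
          (psiPlus k σ * psiMinus k' σ * E) := by
  rw [positionField, positionField, Finset.sum_mul, Finset.sum_mul]
  refine Finset.sum_congr rfl fun k _ => ?_
  rw [Finset.mul_sum, Finset.sum_mul]
  refine Finset.sum_congr rfl fun k' _ => ?_
  rw [smul_mul_smul_comm, smul_mul_assoc, psiPlus, psiMinus]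
  congr 1
  ring

/-- **FINITE-CUTOFF PARSEVAL FOR THE LOCAL DENSITY INSERTION**: for `β > 0`, every covariance `C`, spin `σ` and cofactor `E`,
`Σ_x ∫_{[0,β]} gaussExpect C (ψ⁺_{(x,t)σ} ψ⁻_{(x,t)σ} E) dt = (βL²)⁻¹ Σ_k gaussExpect C (ψ̂⁺_{kσ} ψ̂⁻_{kσ} E)`. -/
theorem sum_integral_gaussExpect_positionField_pair_mul {β : ℝ} (hβ : 0 < β)
    (C : Matrix (HubbardFieldIdx L M) (HubbardFieldIdx L M) ℂ) (σ : Fin 2) (E : HubbardGrassmann L M) :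
    ∑ x : TorusSite 2 L, ∫ t in Set.Icc (0 : ℝ) β,
        gaussExpect ℂ C (positionField L M β 0 σ x t * positionField L M β 1 σ x t * E) =
      (((1 / (β * (L : ℝ) ^ 2) : ℝ) : ℂ)) * ∑ k : FreqMomentum L M, gaussExpect ℂ C (psiPlus k σ * psiMinus k σ * E) := by
  have hβL : ((β * (L : ℝ) ^ 2 : ℝ) : ℂ) ≠ 0 := by
    have hL : (L : ℝ) ≠ 0 := by exact_mod_cast NeZero.ne L
    exact_mod_cast mul_ne_zero hβ.ne' (pow_ne_zero 2 hL)
  set c : ℂ := ((β * (L : ℝ) ^ 2 : ℝ) : ℂ) with hc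
  have hinv : (((1 / (β * (L : ℝ) ^ 2) : ℝ) : ℂ)) = c⁻¹ := by rw [hc]; push_cast; ring
  -- expand the integrand in modes
  have hpt : ∀ (x : TorusSite 2 L) (t : ℝ),
      gaussExpect ℂ C (positionField L M β 0 σ x t * positionField L M β 1 σ x t * E) =
        ∑ k : FreqMomentum L M, ∑ k' : FreqMomentum L M,
          (conj (vertexPlaneWave L M β 0 k x t) * conj (vertexPlaneWave L M β 1 k' x t)) *
            (c⁻¹ ^ 2 * gaussExpect ℂ C (psiPlus k σ * psiMinus k' σ * E)) := by
    intro x t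
    rw [positionField_pair_mul_eq_sum, map_sum]
    refine Finset.sum_congr rfl fun k _ => ?_
    rw [map_sum]
    refine Finset.sum_congr rfl fun k' _ => ?_
    rw [map_smul, smul_eq_mul, hinv]
    ring
  simp_rw [hpt]
  -- integrate termwise (each term is continuous in `t`)
  have hint : ∀ (x : TorusSite 2 L) (k k' : FreqMomentum L M),
      Integrable (fun t : ℝ => (conj (vertexPlaneWave L M β 0 k x t) * conj (vertexPlaneWave L M β 1 k' x t)) *
        (c⁻¹ ^ 2 * gaussExpect ℂ C (psiPlus k σ * psiMinus k' σ * E))) (volume.restrict (Set.Icc (0 : ℝ) β)) := by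
    intro x k k'
    refine (Continuous.integrableOn_Icc ?_)
    simp_rw [conj_vertexPlaneWave_zero_mul_one_eq]
    fun_prop
  have hx : ∀ x : TorusSite 2 L,
      ∫ t in Set.Icc (0 : ℝ) β, ∑ k : FreqMomentum L M, ∑ k' : FreqMomentum L M,
          (conj (vertexPlaneWave L M β 0 k x t) * conj (vertexPlaneWave L M β 1 k' x t)) *
            (c⁻¹ ^ 2 * gaussExpect ℂ C (psiPlus k σ * psiMinus k' σ * E)) =
        ∑ k : FreqMomentum L M, ∑ k' : FreqMomentum L M,
          (∫ t in Set.Icc (0 : ℝ) β, conj (vertexPlaneWave L M β 0 k x t) * conj (vertexPlaneWave L M β 1 k' x t)) *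
            (c⁻¹ ^ 2 * gaussExpect ℂ C (psiPlus k σ * psiMinus k' σ * E)) := by
    intro x
    rw [integral_finsetSum _ (fun k _ => integrable_finsetSum _ (fun k' _ => hint x k k'))]
    refine Finset.sum_congr rfl fun k _ => ?_
    rw [integral_finsetSum _ (fun k' _ => hint x k k')]
    refine Finset.sum_congr rfl fun k' _ => ?_
    rw [integral_mul_const]
  simp_rw [hx]
  rw [Finset.sum_comm]
  simp_rw [Finset.sum_comm (s := (Finset.univ : Finset (TorusSite 2 L))), ← Finset.sum_mul,
    sum_integral_conj_vertexPlaneWave_zero_mul_one hβ, ite_mul, zero_mul, Finset.sum_ite_eq, Finset.mem_univ, if_true, ← hc]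
  rw [Finset.mul_sum]
  refine Finset.sum_congr rfl fun k _ => ?_
  rw [hinv]
  field_simp
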